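import Summits.ABC.ABC.Theorems.LogCardinalitySubPowerStewartYuCases
import Summits.ABC.ABC.Theorems.LogCardinalitySubPowerStewartYuTop
import HarnessLib

/-!
# Sub-power Stewart–Yu (crux `SubPowerStewartYu`, stmt-ABC-11053), VII: the cube bound in all cases

`Summits/ABC/ABC/Theorems/LogCardinalitySubPowerStewartYuMain.lean` — helper file toward
`Summit.ABC.ABC.Theses.LogCardinality.SubPowerStewartYu`.

For an abc triple with `ab > 1` and `L = log R` large (explicit largeness hypotheses), with
`Λ = max(1, log R)`, `Y = log max{e, 2 log c}`, `C₂ = 64 Ā² e⁴`, `c₁ = 1/(144 C₂)`: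

* `case2_bound_a` / `case2_bound_c` — the top-heavy case when the largest top prime sits in `a`
  (resp. `c`): `(log c)³ ≤ 64 K⁹ C³ Λ⁶ Y³ R · e³ e^{−3L/(4C₂ log L)}`
  (Stewart's inflation at the top prime, `top_prime_bound`, fed into `cube_top_case_a/c`);
* `cube_bound` — the dichotomy: either the slack case (`cube_slack_case`) or the top-heavy case,
  giving in all cases `(log c)³ ≤ 64 K⁹ C³ e³ Λ⁶ Y³ R · e^{−3c₁L/log L}`.
[cite: StewartYu2001, Theorem 1 (proof scheme)] [cite: Stewart2013, Lemma 8 (arXiv pp. 9–10)].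
No new definitions.
-/

noncomputable section

-- `Summit.ABC.ABC.…` is the tree's namespace convention for this sub-problem (summit = problem).
set_option linter.dupNamespace false

open Finset Real Height
open Literature.NumberTheory.DiophantineGeometry
open Literature.NumberTheory.DiophantineGeometry.Dioph
open Literature.NumberTheory.DiophantineGeometry.Pasten
open Literature.Barriers.ABC

namespace Summit.ABC.ABC.Theorems.SubPowerSY

section Main

variable {K A : ℝ} {a b c : ℕ}

/-- `∏_{q ∣ uv} log q ≤ theta K u v 0` for `K ≥ 1` (`theta = K^{ω(uv)+1} ∏ log q`). [folklore] -/
theorem prod_log_le_theta (hK : 1 ≤ K) {u v : ℕ} (hu : u ≠ 0) (hv : v ≠ 0) (huv : u.Coprime v) :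
    ∏ q ∈ (u * v).primeFactors, Real.log (q : ℝ) ≤ theta K u v 0 := by
  rw [theta_zero_eq K hu hv huv]
  have h0 : 0 ≤ ∏ q ∈ (u * v).primeFactors, Real.log (q : ℝ) := (prod_log_primeFactors_pos _).le
  exact le_mul_of_one_le_left h0 (one_le_pow₀ hK)

/-- **Top-heavy case, largest top prime in `a`.** [cite: Stewart2013, Lemma 8 (arXiv pp. 9–10)] -/
theorem case2_bound_a (hK : 1 ≤ K) (hP : PastenApproximationBound K)
    (hYu : ∀ (n p : ℕ) (α : Fin n → ℚ) (b : Fin n → ℤ), 1 ≤ n → p.Prime → 5 ≤ p →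
      (∀ i, α i ≠ 0 ∧ padicValRat p (α i) = 0) → (∀ e : Fin n → ℤ, ∏ i, α i ^ e i = 1 → e = 0) →
      b ≠ 0 → (padicValRat p (∏ i, α i ^ b i - 1) : ℝ) ≤
        A ^ n * max ((p : ℝ) * ((n : ℝ) / Real.log p) ^ n) (Real.exp n * Real.log p) *
          (∏ i, max 1 (logHeight₁ (α i))) * max (Real.log (2 + ∑ i, |(b i : ℝ)|)) ((n : ℝ) ^ 2))
    {C : ℝ} (hC1 : 1 ≤ C)
    (hC : ∀ S : Finset ℕ, (∀ p ∈ S, p.Prime) → ∏ p ∈ S, 4 * K ^ 2 * Real.log p ^ 2 / p ≤ C)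
    {C₂ : ℝ} (hC₂ : C₂ = 64 * max |A| 1 ^ 2 * Real.exp 4) {D : ℝ} (hD : 1 ≤ D)
    (h : IsABCTriple a b c) (h1 : 1 < a * b)
    (hL16 : 16 ≤ Real.log (rad a b c : ℕ))
    (hc2 : ∀ x : ℝ, Real.log (rad a b c : ℕ) / 4 ≤ x → 8 * C₂ * Real.log x ^ 2 ≤ x)
    (hc3 : ∀ x : ℝ, Real.log (rad a b c : ℕ) / 4 ≤ x → 6 + Real.log x ≤ 0.001 * x)
    (hc4 : 2 + 6 * Real.log D ≤ Real.log (rad a b c : ℕ) / (8 * C₂ * Real.log (Real.log (rad a b c : ℕ))))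
    (hne : a.primeFactors.Nonempty)
    (htop : Real.log (rad a b c : ℕ) / 4 ≤ Real.log ((max 1 (a.primeFactors.sup id) : ℕ) : ℝ))
    (hra : ∏ p ∈ a.primeFactors.erase (max 1 (a.primeFactors.sup id)), (p : ℝ) <
      D ^ 2 * Real.exp (6 * (1 / (144 * C₂)) * Real.log (rad a b c : ℕ) / Real.log (Real.log (rad a b c : ℕ))))
    (hn : (((b * c).primeFactors.card : ℕ) : ℝ) ≤
      2 + 6 * Real.log D + Real.log (rad a b c : ℕ) / (8 * C₂ * Real.log (Real.log (rad a b c : ℕ)))) :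
    Real.log c ^ 3 ≤ 64 * K ^ 9 * C ^ 3 * max 1 (Real.log (rad a b c : ℕ)) ^ 6 *
      Real.log (max (Real.exp 1) (2 * Real.log c)) ^ 3 * (rad a b c : ℝ) *
      (Real.exp 3 * Real.exp (-(3 * Real.log (rad a b c : ℕ)) /
        (4 * C₂ * Real.log (Real.log (rad a b c : ℕ))))) := by
  classical
  obtain ⟨ha, hb, habc, hcop⟩ := id h
  have hc : 0 < c := by omega
  have hbc : b.Coprime c := coprime_right_of_isABCTriple h
  have hac : a.Coprime c := coprime_left_of_isABCTriple h
  have habc0 : a * b * c ≠ 0 := by positivity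
  set P : ℕ := max 1 (a.primeFactors.sup id) with hPdef
  set L := Real.log (rad a b c : ℕ) with hLdef
  have hpos1 : ∀ q ∈ a.primeFactors, 1 ≤ q := fun q hq => (Nat.prime_of_mem_primeFactors hq).one_lt.le
  have hPS : P ∈ a.primeFactors := top_mem a.primeFactors hne hpos1
  have hPp : P.Prime := Nat.prime_of_mem_primeFactors hPS
  have hPa : P ∣ a := Nat.dvd_of_mem_primeFactors hPS
  -- `P ∤ bc`
  have hPbc : ¬ P ∣ b * c := by
    intro hd
    rcases (Nat.Prime.dvd_mul hPp).mp hd with hdb | hdc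
    · exact hPp.one_lt.ne' (Nat.dvd_one.mp (hcop.gcd_eq_one ▸ Nat.dvd_gcd hPa hdb))
    · exact hPp.one_lt.ne' (Nat.dvd_one.mp (hac.gcd_eq_one ▸ Nat.dvd_gcd hPa hdc))
  -- `log P ≤ L`
  have hPL : Real.log P ≤ L := by
    have := log_le_max_log_rad h (Dvd.intro (b * c) (by ring)) P hPS
    -- `max 1 L = L` as `L ≥ 16`
    rwa [max_eq_right (by linarith : (1 : ℝ) ≤ L)] at this
  -- `bc > 1`, `log (bc) ≤ 2 log c`
  have h1bc : 1 < b * c := by nlinarith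
  have hy0 : 0 ≤ Real.log c := Real.log_nonneg (by exact_mod_cast hc)
  have hlogbc : Real.log ((b * c : ℕ) : ℝ) ≤ 2 * Real.log c := by
    have hb' : (0 : ℝ) < b := by exact_mod_cast hb
    have hc' : (0 : ℝ) < c := by exact_mod_cast hc
    have hbc' : Real.log b ≤ Real.log c :=
      Real.log_le_log hb' (by exact_mod_cast (show b ≤ c by omega))
    push_cast
    rw [Real.log_mul hb'.ne' hc'.ne']
    linarith
  -- the engine at the top prime
  obtain ⟨X, hX1, hX2, hinf⟩ := top_prime_bound hYu hC₂ hD hb hc hbc h1bc hy0 hlogbc hPp hPbc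
    hL16 htop hPL hc2 hc3 hc4 hn
  -- the bound at the top prime in the form consumed by `cube_top_case_a`
  have hΘ : ∏ q ∈ (b * c).primeFactors, Real.log (q : ℝ) ≤ theta K b c 0 :=
    prod_log_le_theta hK hb.ne' hc.ne' hbc
  have hlogP0 : 0 ≤ Real.log P := Real.log_nonneg (by exact_mod_cast hPp.one_lt.le)
  have hY1 : 1 ≤ Real.log (max (Real.exp 1) (2 * Real.log c)) := one_le_log_max_exp _
  have hra' : ∏ p ∈ a.primeFactors.erase P, (p : ℝ) ≤ X := (le_of_lt hra).trans hX1
  have hX0 : 0 ≤ X := le_trans (Finset.prod_nonneg fun q _ => Nat.cast_nonneg q) hra'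
  have htop' : (a.factorization P : ℝ) * Real.log P ≤
      theta K b c 0 * Real.log (max (Real.exp 1) (2 * Real.log c)) * (3 * X) := by
    have hval := factorization_le_padicValRat_sq_sub_one_a h hPS
    calc (a.factorization P : ℝ) * Real.log P
        ≤ (padicValRat P ((((b : ℚ) / c) ^ 2) - 1) : ℝ) * Real.log P :=
          mul_le_mul_of_nonneg_right hval hlogP0
      _ ≤ (∏ q ∈ (b * c).primeFactors, Real.log (q : ℝ)) *
            Real.log (max (Real.exp 1) (2 * Real.log c)) * (3 * X) := hinf
      _ ≤ theta K b c 0 * Real.log (max (Real.exp 1) (2 * Real.log c)) * (3 * X) := by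
          apply mul_le_mul_of_nonneg_right _ (by positivity)
          exact mul_le_mul_of_nonneg_right hΘ (by linarith)
  have hcube := cube_top_case_a hK hP hC1 hC h h1 hne hra' htop'
  -- `X / P ≤ e³ e^{-3L/(4 C₂ log L)}`
  have hP0 : (0 : ℝ) < P := by exact_mod_cast hPp.pos
  have hXP : X / (P : ℝ) ≤ Real.exp 3 * Real.exp (-(3 * L) / (4 * C₂ * Real.log L)) := by
    rw [div_le_iff₀ hP0]
    calc X ≤ (P : ℝ) * Real.exp 3 * Real.exp (-(3 * L) / (4 * C₂ * Real.log L)) := hX2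
      _ = Real.exp 3 * Real.exp (-(3 * L) / (4 * C₂ * Real.log L)) * P := by ring
  have hpre : 0 ≤ 64 * K ^ 9 * C ^ 3 * max 1 L ^ 6 *
      Real.log (max (Real.exp 1) (2 * Real.log c)) ^ 3 * (rad a b c : ℝ) := by
    have : 0 ≤ K := by linarith
    have : 0 ≤ C := by linarith
    positivity
  exact hcube.trans (mul_le_mul_of_nonneg_left hXP hpre)

/-- **Top-heavy case, largest top prime in `c`.** [cite: Stewart2013, Lemma 8 (arXiv pp. 9–10)] -/
theorem case2_bound_c (hK : 1 ≤ K) (hP : PastenApproximationBound K)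
    (hYu : ∀ (n p : ℕ) (α : Fin n → ℚ) (b : Fin n → ℤ), 1 ≤ n → p.Prime → 5 ≤ p →
      (∀ i, α i ≠ 0 ∧ padicValRat p (α i) = 0) → (∀ e : Fin n → ℤ, ∏ i, α i ^ e i = 1 → e = 0) →
      b ≠ 0 → (padicValRat p (∏ i, α i ^ b i - 1) : ℝ) ≤
        A ^ n * max ((p : ℝ) * ((n : ℝ) / Real.log p) ^ n) (Real.exp n * Real.log p) *
          (∏ i, max 1 (logHeight₁ (α i))) * max (Real.log (2 + ∑ i, |(b i : ℝ)|)) ((n : ℝ) ^ 2))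
    {C : ℝ} (hC1 : 1 ≤ C)
    (hC : ∀ S : Finset ℕ, (∀ p ∈ S, p.Prime) → ∏ p ∈ S, 4 * K ^ 2 * Real.log p ^ 2 / p ≤ C)
    {C₂ : ℝ} (hC₂ : C₂ = 64 * max |A| 1 ^ 2 * Real.exp 4) {D : ℝ} (hD : 1 ≤ D)
    (h : IsABCTriple a b c) (h1 : 1 < a * b)
    (hL16 : 16 ≤ Real.log (rad a b c : ℕ))
    (hc2 : ∀ x : ℝ, Real.log (rad a b c : ℕ) / 4 ≤ x → 8 * C₂ * Real.log x ^ 2 ≤ x)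
    (hc3 : ∀ x : ℝ, Real.log (rad a b c : ℕ) / 4 ≤ x → 6 + Real.log x ≤ 0.001 * x)
    (hc4 : 2 + 6 * Real.log D ≤ Real.log (rad a b c : ℕ) / (8 * C₂ * Real.log (Real.log (rad a b c : ℕ))))
    (hne : c.primeFactors.Nonempty)
    (htop : Real.log (rad a b c : ℕ) / 4 ≤ Real.log ((max 1 (c.primeFactors.sup id) : ℕ) : ℝ))
    (hrc : ∏ p ∈ c.primeFactors.erase (max 1 (c.primeFactors.sup id)), (p : ℝ) <
      D ^ 2 * Real.exp (6 * (1 / (144 * C₂)) * Real.log (rad a b c : ℕ) / Real.log (Real.log (rad a b c : ℕ))))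
    (hn : (((a * b).primeFactors.card : ℕ) : ℝ) ≤
      2 + 6 * Real.log D + Real.log (rad a b c : ℕ) / (8 * C₂ * Real.log (Real.log (rad a b c : ℕ)))) :
    Real.log c ^ 3 ≤ 64 * K ^ 9 * C ^ 3 * max 1 (Real.log (rad a b c : ℕ)) ^ 6 *
      Real.log (max (Real.exp 1) (2 * Real.log c)) ^ 3 * (rad a b c : ℝ) *
      (Real.exp 3 * Real.exp (-(3 * Real.log (rad a b c : ℕ)) /
        (4 * C₂ * Real.log (Real.log (rad a b c : ℕ))))) := by
  classical
  obtain ⟨ha, hb, habc, hcop⟩ := id h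
  have hc : 0 < c := by omega
  have hbc : b.Coprime c := coprime_right_of_isABCTriple h
  have hac : a.Coprime c := coprime_left_of_isABCTriple h
  have habc0 : a * b * c ≠ 0 := by positivity
  set P : ℕ := max 1 (c.primeFactors.sup id) with hPdef
  set L := Real.log (rad a b c : ℕ) with hLdef
  have hpos1 : ∀ q ∈ c.primeFactors, 1 ≤ q := fun q hq => (Nat.prime_of_mem_primeFactors hq).one_lt.le
  have hPS : P ∈ c.primeFactors := top_mem c.primeFactors hne hpos1
  have hPp : P.Prime := Nat.prime_of_mem_primeFactors hPS
  have hPc : P ∣ c := Nat.dvd_of_mem_primeFactors hPS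
  -- `P ∤ ab`
  have hPab : ¬ P ∣ a * b := by
    intro hd
    rcases (Nat.Prime.dvd_mul hPp).mp hd with hda | hdb
    · exact hPp.one_lt.ne' (Nat.dvd_one.mp (hac.gcd_eq_one ▸ Nat.dvd_gcd hda hPc))
    · exact hPp.one_lt.ne' (Nat.dvd_one.mp (hbc.gcd_eq_one ▸ Nat.dvd_gcd hdb hPc))
  have hPL : Real.log P ≤ L := by
    have := log_le_max_log_rad h (Dvd.intro_left (a * b) rfl) P hPS
    rwa [max_eq_right (by linarith : (1 : ℝ) ≤ L)] at this
  have hy0 : 0 ≤ Real.log c := Real.log_nonneg (by exact_mod_cast hc)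
  have hlogab : Real.log ((a * b : ℕ) : ℝ) ≤ 2 * Real.log c := by
    have ha' : (0 : ℝ) < a := by exact_mod_cast ha
    have hb' : (0 : ℝ) < b := by exact_mod_cast hb
    have hac' : Real.log a ≤ Real.log c :=
      Real.log_le_log ha' (by exact_mod_cast (show a ≤ c by omega))
    have hbc' : Real.log b ≤ Real.log c :=
      Real.log_le_log hb' (by exact_mod_cast (show b ≤ c by omega))
    push_cast
    rw [Real.log_mul ha'.ne' hb'.ne']
    linarith
  obtain ⟨X, hX1, hX2, hinf⟩ := top_prime_bound hYu hC₂ hD ha hb hcop h1 hy0 hlogab hPp hPab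
    hL16 htop hPL hc2 hc3 hc4 hn
  have hΘ : ∏ q ∈ (a * b).primeFactors, Real.log (q : ℝ) ≤ theta K a b 0 :=
    prod_log_le_theta hK ha.ne' hb.ne' hcop
  have hlogP0 : 0 ≤ Real.log P := Real.log_nonneg (by exact_mod_cast hPp.one_lt.le)
  have hY1 : 1 ≤ Real.log (max (Real.exp 1) (2 * Real.log c)) := one_le_log_max_exp _
  have hrc' : ∏ p ∈ c.primeFactors.erase P, (p : ℝ) ≤ X := (le_of_lt hrc).trans hX1
  have hX0 : 0 ≤ X := le_trans (Finset.prod_nonneg fun q _ => Nat.cast_nonneg q) hrc'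
  have htop' : (c.factorization P : ℝ) * Real.log P ≤
      theta K a b 0 * Real.log (max (Real.exp 1) (2 * Real.log c)) * (3 * X) := by
    have hval := factorization_le_padicValRat_sq_sub_one_c h h1 hPS
    calc (c.factorization P : ℝ) * Real.log P
        ≤ (padicValRat P ((((a : ℚ) / b) ^ 2) - 1) : ℝ) * Real.log P :=
          mul_le_mul_of_nonneg_right hval hlogP0
      _ ≤ (∏ q ∈ (a * b).primeFactors, Real.log (q : ℝ)) *
            Real.log (max (Real.exp 1) (2 * Real.log c)) * (3 * X) := hinf
      _ ≤ theta K a b 0 * Real.log (max (Real.exp 1) (2 * Real.log c)) * (3 * X) := by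
          apply mul_le_mul_of_nonneg_right _ (by positivity)
          exact mul_le_mul_of_nonneg_right hΘ (by linarith)
  have hcube := cube_top_case_c hK hP hC1 hC h h1 hne hrc' htop'
  have hP0 : (0 : ℝ) < P := by exact_mod_cast hPp.pos
  have hXP : X / (P : ℝ) ≤ Real.exp 3 * Real.exp (-(3 * L) / (4 * C₂ * Real.log L)) := by
    rw [div_le_iff₀ hP0]
    calc X ≤ (P : ℝ) * Real.exp 3 * Real.exp (-(3 * L) / (4 * C₂ * Real.log L)) := hX2
      _ = Real.exp 3 * Real.exp (-(3 * L) / (4 * C₂ * Real.log L)) * P := by ring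
  have hpre : 0 ≤ 64 * K ^ 9 * C ^ 3 * max 1 L ^ 6 *
      Real.log (max (Real.exp 1) (2 * Real.log c)) ^ 3 * (rad a b c : ℝ) := by
    have : 0 ≤ K := by linarith
    have : 0 ≤ C := by linarith
    positivity
  exact hcube.trans (mul_le_mul_of_nonneg_left hXP hpre)

end Main

end Summit.ABC.ABC.Theorems.SubPowerSY

end
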